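import Summits.BirchSwinnertonDyer.BirchSwinnertonDyer.Theses.SignedLowerHalves
import Summits.BirchSwinnertonDyer.Rank1Residual.Supersingular.KobayashiMainConjectureKuriharaRigidity
import Summits.BirchSwinnertonDyer.Rank1Residual.Partition.MainConjecturesSignedLowerDivisibility
import Literature.NumberTheory.EllipticCurves.Rank1Residual.Typed.X7
import HarnessLib

/-!
# Crux `KobayashiLowerHalfLargeImage` (item stmt-BirchSwinnertonDyer-19001), line `kurihara_rigidity`: the crux on the
# large-image corner of X7 at `p ≥ 5` is EQUIVALENT to Kim's Conjecture 1.10 there — modulo the line's named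
# inputs in BOTH directions (Kim 1.11 ∘ Kobayashi 7.4 [PUB], Castella–Sano Thm 1 ∘ Kobayashi 7.4 in both directions
# + the §2 reading [PRE], Kobayashi 1.2 / 4.1 [PUB], the period facts [PUB]) — so the line's one open stub
# (`stub_kuriharaPartialInfty_le_tamagawa_X7`, with its `≥` twin) is EXACTLY crux-sized, in Kurihara currency
# (cell `bsd-ssimc`, seat `bsd-line-slh-p1`, lead of the line)

HONEST FRAMING (D-0152): theorems only, CONDITIONAL on displayed named facts / OPEN preprint binders; nothing is
closed or booked; BSD is not proved by any of this. What is shown: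
* `X7.kimTamagawaDefectAt_of_kobayashiLowerDivisibility` — at an X7 ∧ ¬CM ∧ Surj pair, `p ≥ 5`, the crux's
  conclusion for ONE sign (`KobayashiLowerDivisibility W p ε`), squeezed against Kobayashi Thm 4.1 into that sign's
  main conjecture (`kobayashiMainConjecture_of_lowerDivisibility_of_thm41`, tree theorem on the named facts `h12`,
  `h41`, `h5`, `h3`), gives Kim's Conjecture 1.10 `X4.KimTamagawaDefectAt W p f` for every newform `f` of `W`
  (converse binder `Kobayashi74_CastellaSano2026_kimTamagawaDefect_of_signedMC_OPEN`);
* `kimTamagawaDefect_X7_of_kobayashiLowerHalfLargeImage` — hence the crux BY NAME implies Kim's Conjecture 1.10 on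
  the whole large-image corner of X7 at `p ≥ 5`;
* `kobayashiLowerHalfLargeImage_iff_kimTamagawaDefect_X7` — THE EQUIVALENCE: crux 3 ⟺ (Kim's Conjecture 1.10 for
  the newform of every X7 ∧ ¬CM ∧ `a_p = 0` ∧ Surj pair at `p ≥ 5`) ∧ (the crux's own conclusion at `p = 3`),
  modulo the named inputs (forward: `…KuriharaRigidityFacts`; backward: this file).
READING FOR THE PLANNER: promoting the line's hard stub to an item re-keys crux 3 (at `p ≥ 5`) faithfully into
Kurihara currency — `X4.KimTamagawaDefect(Le)At` on X7 — the same typed object the X4 / N10 rows of cell b2b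
consume; nothing is lost or gained class-wide, but the statement becomes conductor-blind and Σ⁰₁ per pair.

References: [Kobayashi2003] Thm 1.2, Thm 4.1, Thm 7.4, Conjecture (p. 2); [CastellaSano2026] Thm 1, §2 (PRE);
[Kim2022StructureSelmer] Thm 1.11, Conj 1.10; [GreenbergVatsal2000] §3 Rem 3.4; [Wuthrich2014] Lemma 20.
-/

set_option autoImplicit false
-- the Theorems namespace of a single-conjunct summit repeats the summit name by design (D-0017)
set_option linter.dupNamespace false

noncomputable section

open scoped Classical MatrixGroups ModularForm

open CongruenceSubgroup WeierstrassCurve Literature.NumberTheory.EllipticCurves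
  Literature.NumberTheory.EllipticCurves.ModularForms
  Literature.NumberTheory.EllipticCurves.Rank1Residual
  Literature.NumberTheory.EllipticCurves.Rank1Residual.Typed
  Summit.BirchSwinnertonDyer.Rank1Residual.Supersingular
  Summit.BirchSwinnertonDyer.Rank1Residual.X4

namespace Summit.BirchSwinnertonDyer.BirchSwinnertonDyer.Theorems.KuriharaRigidity

variable (W : WeierstrassCurve ℚ) [W.IsElliptic] [W.IsGloballyMinimal] (p : ℕ) [Fact p.Prime]

/-- **The crux's conclusion at an X7 ∧ ¬CM ∧ Surj pair (`p ≥ 5`) gives Kim's Conjecture 1.10 for every newform of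
`W`**, GRANTED Kobayashi Thm 1.2 (`h12`), Thm 4.1 (`h41`), the period facts (`h5`, `h3`) — which squeeze the
Eisenstein half `KobayashiLowerDivisibility W p ε` into `KobayashiMainConjecture W p ε`
(`kobayashiMainConjecture_of_lowerDivisibility_of_thm41`) — and the converse binder
`Kobayashi74_CastellaSano2026_kimTamagawaDefect_of_signedMC_OPEN` (`hC`, Castella–Sano half unrefereed).
CONDITIONAL; closes nothing. [cite: Kobayashi2003, Thm. 1.2, Thm. 4.1 (p. 8) and Thm. 7.4 (p. 13)]
[claim: CastellaSano2026, status: under-review] [cite: GreenbergVatsal2000, §3, Remark 3.4] -/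
theorem X7.kimTamagawaDefectAt_of_kobayashiLowerDivisibility
    (hC : Kobayashi74_CastellaSano2026_kimTamagawaDefect_of_signedMC_OPEN)
    (h12 : Kobayashi2003.thm12_signedSelmerDual_finite_torsion)
    (h41 : Kobayashi2003.thm41_signedCharIdeal_divisibility)
    (h5 : realPeriodRat_eq_unit_mul_plusPeriod) (h3 : realPeriodRat_eq_unit_mul_plusPeriod_three)
    (hp5 : 5 ≤ p) (hX : ClassX7 W p) (hcm : ¬ W.HasCM) (hap : W.frobeniusTrace p = 0) (hs : Surj W p)
    {ε : ℤˣ} (hlow : KobayashiLowerDivisibility W p ε)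
    {N : ℕ} [NeZero N] (f : CuspForm (Gamma0 N) 2) (hf : IsNewformOf W f) : KimTamagawaDefectAt W p f :=
  Summit.BirchSwinnertonDyer.Rank1Residual.Supersingular.KuriharaRigidity.kimTamagawaDefectAt_of_signedMC hC h5
    W p hp5 hX.1.1 hap hcm hs
    (kobayashiMainConjecture_of_lowerDivisibility_of_thm41 h12 h41 h5 h3 W p (by omega) hX.1.1 hap hs ε hlow)
    f hf

/-- **The crux BY NAME implies Kim's Conjecture 1.10 on the whole large-image corner of X7 at `p ≥ 5`** (for the
newform at the conductor, as the line's stubs are typed), GRANTED `hC`, `h12`, `h41`, `h5`, `h3`. CONDITIONAL.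
[cite: Kobayashi2003, Thm. 4.1 (p. 8) and Thm. 7.4 (p. 13)] [claim: CastellaSano2026, status: under-review]
[cite: Kim2022StructureSelmer, Conj. 1.10 (PDF p. 8)] -/
theorem kimTamagawaDefect_X7_of_kobayashiLowerHalfLargeImage
    (hC : Kobayashi74_CastellaSano2026_kimTamagawaDefect_of_signedMC_OPEN)
    (h12 : Kobayashi2003.thm12_signedSelmerDual_finite_torsion)
    (h41 : Kobayashi2003.thm41_signedCharIdeal_divisibility)
    (h5 : realPeriodRat_eq_unit_mul_plusPeriod) (h3 : realPeriodRat_eq_unit_mul_plusPeriod_three)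
    (hcrux : Summit.BirchSwinnertonDyer.BirchSwinnertonDyer.Theses.SignedLowerHalves.KobayashiLowerHalfLargeImage) :
    ∀ (W : WeierstrassCurve ℚ) [W.IsElliptic] [W.IsGloballyMinimal] (p : ℕ) [Fact p.Prime],
      5 ≤ p → ClassX7 W p → ¬ W.HasCM → W.frobeniusTrace p = 0 → Surj W p →
      ∀ [NeZero (W.conductorNorm ℤ)] (f : CuspForm (Gamma0 (W.conductorNorm ℤ)) 2),
        IsNewformOf W f → KimTamagawaDefectAt W p f := by
  intro W _ _ p _ hp5 hX hcm hap hs _ f hf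
  obtain ⟨ε, hlow⟩ := hcrux W p (by omega) hX hcm hap hs
  exact X7.kimTamagawaDefectAt_of_kobayashiLowerDivisibility W p hC h12 h41 h5 h3 hp5 hX hcm hap hs hlow f hf

/-- **THE EQUIVALENCE.** Modulo the line's named inputs — (⇐) `CastellaSano2026_thm1_via_kobayashi74_OPEN`
(`hCS`, Castella–Sano Thm 1 (i)⇒(ii) PRE ∘ Kobayashi 7.4 PUB) and the period fact `h5`; (⇒)
`Kobayashi74_CastellaSano2026_kimTamagawaDefect_of_signedMC_OPEN` (`hC`, Kobayashi 7.4 PUB ∘ Castella–Sano (ii)⇒(i)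
PRE), Kobayashi Thm 1.2 / 4.1 (`h12`, `h41`, PUB), `h5`, `h3` — the crux `KobayashiLowerHalfLargeImage` is
EQUIVALENT to: Kim's Conjecture 1.10 (`X4.KimTamagawaDefectAt`) for the newform of every X7 ∧ ¬CM ∧ `a_p = 0` ∧
Surj pair at `p ≥ 5`, together with the crux's own conclusion at `p = 3`. (With `Kim2026_thm111_via_kobayashi74`
and the §2 reading, the `p ∤ ∏ c_ℓ` rows of (⇐) need the `≤` half and PUBLISHED inputs only:
`kobayashiLowerHalfLargeImage_of_kim111_of_castellaSano_readings_OPEN`.) So the line `kurihara_rigidity` RE-KEYS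
crux 3 (at `p ≥ 5`) faithfully into Kurihara currency; its open stub is exactly crux-sized.
CONDITIONAL; closes nothing; BSD is not proved by any of this.
[cite: Kim2022StructureSelmer, Thm. 1.11 and Conj. 1.10 (PDF p. 8)] [cite: Kobayashi2003, Thm. 1.2, Thm. 4.1, Thm. 7.4]
[claim: CastellaSano2026, status: under-review] [cite: GreenbergVatsal2000, §3, Remark 3.4] -/
theorem kobayashiLowerHalfLargeImage_iff_kimTamagawaDefect_X7
    (hCS : CastellaSano2026_thm1_via_kobayashi74_OPEN)
    (hC : Kobayashi74_CastellaSano2026_kimTamagawaDefect_of_signedMC_OPEN)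
    (h12 : Kobayashi2003.thm12_signedSelmerDual_finite_torsion)
    (h41 : Kobayashi2003.thm41_signedCharIdeal_divisibility)
    (h5 : realPeriodRat_eq_unit_mul_plusPeriod) (h3 : realPeriodRat_eq_unit_mul_plusPeriod_three) :
    Summit.BirchSwinnertonDyer.BirchSwinnertonDyer.Theses.SignedLowerHalves.KobayashiLowerHalfLargeImage ↔
      ((∀ (W : WeierstrassCurve ℚ) [W.IsElliptic] [W.IsGloballyMinimal] (p : ℕ) [Fact p.Prime],
          5 ≤ p → ClassX7 W p → ¬ W.HasCM → W.frobeniusTrace p = 0 → Surj W p →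
          ∀ [NeZero (W.conductorNorm ℤ)] (f : CuspForm (Gamma0 (W.conductorNorm ℤ)) 2),
            IsNewformOf W f → KimTamagawaDefectAt W p f) ∧
        (∀ (W : WeierstrassCurve ℚ) [W.IsElliptic] [W.IsGloballyMinimal] (p : ℕ) [Fact p.Prime],
          p = 3 → ClassX7 W p → ¬ W.HasCM → W.frobeniusTrace p = 0 → Surj W p →
          ∃ ε : ℤˣ, KobayashiLowerDivisibility W p ε)) := by
  constructor
  · intro hcrux
    refine ⟨kimTamagawaDefect_X7_of_kobayashiLowerHalfLargeImage hC h12 h41 h5 h3 hcrux, ?_⟩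
    intro W _ _ p _ hp3 hX hcm hap hs
    exact hcrux W p (by omega) hX hcm hap hs
  · rintro ⟨hKim, h3'⟩
    intro W _ _ p _ hp2 hX hcm hap hs
    have hpP : p.Prime := Fact.out
    by_cases hp5 : 5 ≤ p
    · exact ⟨1, kobayashiLowerDivisibility_of_mainConjecture
        (Summit.BirchSwinnertonDyer.Rank1Residual.Supersingular.KuriharaRigidity.signedMC_of_kimTamagawaDefect
          hCS h5 W p hp5 hX.1.1 hap hcm hs (fun f hf => hKim W p hp5 hX hcm hap hs f hf) 1)⟩
    · have hp3 : p = 3 := by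
        have h2 := hpP.two_le
        interval_cases p
        · exact absurd rfl hp2
        · rfl
        · exact absurd hpP (by decide)
      exact h3' W p hp3 hX hcm hap hs

end Summit.BirchSwinnertonDyer.BirchSwinnertonDyer.Theorems.KuriharaRigidity

end
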